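import Literature.NumberTheory.GaloisRepresentations.LubinTateField
import HarnessLib

/-!
# The Lubin–Tate logarithm `λ_f ∈ F⟦X⟧`

Topic `NumberTheory/GaloisRepresentations`; namespace `Literature.NumberTheory.GaloisRepresentations`.

For a non-archimedean local field `F`, a uniformiser `π` and `f = πX + X^q` (`ltPoly`), the
**logarithm** of the Lubin–Tate formal group `F_f` is the unique `λ_f ∈ F⟦X⟧` with
`λ_f ≡ X (mod deg 2)` and `λ_f(f(X)) = π · λ_f(X)`; it satisfies `λ_f ∘ [a]_f = a · λ_f` for all
`a ∈ 𝒪_F` (de Shalit, *Iwasawa theory of elliptic curves with CM*, I §1.2; Lang, *Cyclotomic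
Fields II*, Ch. 8 §6: `λ = lim π⁻ⁿ[πⁿ]_f`; it is the isomorphism `F_f ≅ 𝔾̂_a` over `F`).

Here `λ_f` comes for free from the tree's Lubin–Tate lemma (`LubinTate.hom`, `eq_hom`,
`hom_comp_hom`), applied over the FIELD `F`: for the unit `π ∈ F` the Lubin–Tate hypotheses
`IsLTRing π q F` hold (`isLTRing_field`: `1 - π^m` is a unit as `|π| < 1`; the congruences modulo
`π` are vacuous), both `f` and the linear series `πX` lie in `𝔉_π` over `F`, and
`λ_f = [1]_{πX, f}` is Lubin–Tate's canonical homomorphism `F_f → F_{πX} = 𝔾̂_a`: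

* `ltLog hπ`, `constantCoeff_ltLog`, `coeff_one_ltLog`, `subst_ltPolyF_ltLog` (the functional
  equation), `eq_ltLog` (uniqueness);
* `hom_mulSeries` (`[b]_{πX,πX} = bX`), `hom_ltPolyF` (`[b]_f` over `F` is `[b]_f` over `𝒪_F`),
  `subst_hom_ltLog` : **`λ_f ∘ [b]_f = b · λ_f`**.

This is the power-series input for the Lubin–Tate period `t_π = λ_f({ω}) ∈ B_dR⁺` of the
Lubin–Tate character (Colmez 1993 §I), cf. the notes of the provefact unit for
`HeckeCharacter.exists_lAdic_isDeRhamFramed`.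

## References

* [LubinTate1965] J. Lubin, J. Tate, *Formal complex multiplication in local fields*, Ann. of
  Math. 81 (1965), §1 Lemma 1 and Thm. 1.
* [CasselsFrohlichANT1967] J.-P. Serre, *Local class field theory* (Cassels–Fröhlich Ch. VI),
  §3.5 Prop. 5.
* [deShalit1987] E. de Shalit, *Iwasawa theory of elliptic curves with complex multiplication*
  (1987), Ch. I §1.2 (the logarithm `λ` of a relative Lubin–Tate group).
-/

noncomputable section

open MvPowerSeries

namespace Literature.NumberTheory.GaloisRepresentations

open ValuativeRel IsLocalRing Field IsNonarchimedeanLocalField LubinTate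

variable (F : Type) [Field F] [ValuativeRel F] [TopologicalSpace F] [IsNonarchimedeanLocalField F]

/-- **Over the field `F` itself the Lubin–Tate hypotheses hold for a uniformiser**: `π` is not a
zero divisor, `1 - π^m` is a unit for `m > 0` (as `v(π^m) < 1`), and the two congruence conditions
are vacuous (`π` is a unit of `F`). [folklore] -/
theorem isLTRing_field {π : F} (hπ : (valuation F).IsUniformizer π) :
    IsLTRing π (residueFieldCard F) := by
  have hπu : IsUnit π := (Ne.isUnit hπ.ne_zero)
  refine ⟨fun x hx => ?_, fun m hm => ?_, ?_, fun a => hπu.dvd⟩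
  · exact (mul_eq_zero.mp hx).resolve_left hπ.ne_zero
  · refine Ne.isUnit (sub_ne_zero.mpr fun h => ?_)
    have hv : valuation F (π ^ m) < 1 := by
      rw [map_pow]; exact pow_lt_one' hπ.val_lt_one (Nat.pos_iff_ne_zero.mp hm)
    rw [← h, map_one] at hv
    exact lt_irrefl _ hv
  · obtain ⟨r, hr, hq⟩ := residueFieldCard_eq_pow_ringChar F
    letI : Fintype 𝓀[F] := Fintype.ofFinite _
    exact ⟨ringChar 𝓀[F], r, CharP.char_is_prime 𝓀[F] _, hq,
      Ideal.mem_span_singleton.mpr hπu.dvd⟩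

/-- Over `F`, ANY series `≡ πX (mod deg 2)` without constant term is a Lubin–Tate series for the
unit `π` (the congruence modulo `π` is vacuous). [folklore] -/
theorem isLTSeries_field {π : F} (hπ0 : π ≠ 0) {g : PowerSeries F}
    (h0 : PowerSeries.constantCoeff g = 0) (h1 : PowerSeries.coeff 1 g = π) :
    IsLTSeries π (residueFieldCard F) g :=
  ⟨h0, h1, fun _ => (Ne.isUnit hπ0).dvd⟩

/-- `f = πX + X^q` viewed over `F`. [cite: CasselsFrohlichANT1967, Ch. VI §3.3 Example (a)] -/
def ltPolyF (π : 𝒪[F]) : PowerSeries F :=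
  PowerSeries.map (algebraMap 𝒪[F] F) ((ltPoly F π : Polynomial 𝒪[F]) : PowerSeries 𝒪[F])

/-- `πX`, the "multiplication by `π`" of the additive group, over `F`. [folklore] -/
def mulSeries (π : 𝒪[F]) : PowerSeries F := PowerSeries.C ((π : 𝒪[F]) : F) * PowerSeries.X

omit [TopologicalSpace F] [IsNonarchimedeanLocalField F] in
/-- Unfolding of `mulSeries`. [folklore] -/
theorem mulSeries_def (π : 𝒪[F]) : mulSeries F π = PowerSeries.C ((π : 𝒪[F]) : F) * PowerSeries.X := rfl

omit [TopologicalSpace F] [IsNonarchimedeanLocalField F] in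
/-- Substituting into `πX`: `(πX)(a) = π·a`. [folklore] -/
theorem subst_mulSeries (π : 𝒪[F]) {τ : Type*} {a : MvPowerSeries τ F} (ha : MvPowerSeries.constantCoeff a = 0) :
    PowerSeries.subst a (mulSeries F π) = MvPowerSeries.C ((π : 𝒪[F]) : F) * a := by
  have hs : PowerSeries.HasSubst a := PowerSeries.HasSubst.of_constantCoeff_zero ha
  rw [mulSeries_def, PowerSeries.subst_mul hs, PowerSeries.subst_C, PowerSeries.subst_X hs]

/-- `map` commutes with one-variable substitution (change of rings). [folklore] -/
theorem map_subst₁F {R S : Type*} [CommRing R] [CommRing S] (h : R →+* S) {a : PowerSeries R}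
    (ha : PowerSeries.constantCoeff a = 0) (g : PowerSeries R) :
    PowerSeries.map h (PowerSeries.subst a g) =
      PowerSeries.subst (PowerSeries.map h a) (PowerSeries.map h g) :=
  PowerSeries.map_subst (PowerSeries.HasSubst.of_constantCoeff_zero' ha) g

variable {F}
variable {π : 𝒪[F]} (hπ : (valuation F).IsUniformizer (π : F))

/-- `f = πX + X^q ∈ 𝔉_π` over `F`. [folklore] -/
theorem isLTSeries_ltPolyF : IsLTSeries ((π : 𝒪[F]) : F) (residueFieldCard F) (ltPolyF F π) := by
  refine ⟨?_, ?_, fun n => ?_⟩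
  · rw [ltPolyF, ← PowerSeries.coeff_zero_eq_constantCoeff_apply, PowerSeries.coeff_map,
      PowerSeries.coeff_zero_eq_constantCoeff_apply, (isLTSeries_ltPoly F).constantCoeff_eq_zero, map_zero]
  · rw [ltPolyF, PowerSeries.coeff_map, (isLTSeries_ltPoly F).coeff_one]; rfl
  · obtain ⟨c, hc⟩ := (isLTSeries_ltPoly F (π := π)).dvd_coeff_sub n
    refine ⟨algebraMap 𝒪[F] F c, ?_⟩
    rw [ltPolyF, PowerSeries.coeff_map, show ((π : 𝒪[F]) : F) = algebraMap 𝒪[F] F π from rfl,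
      ← map_mul, ← hc, map_sub]
    congr 1
    split_ifs <;> simp

include hπ in
/-- `πX ∈ 𝔉_π` over `F`. [folklore] -/
theorem isLTSeries_mulSeries : IsLTSeries ((π : 𝒪[F]) : F) (residueFieldCard F) (mulSeries F π) :=
  isLTSeries_field F hπ.ne_zero (by simp [mulSeries]) (by simp [mulSeries])

/-- **The Lubin–Tate logarithm `λ_f ∈ F⟦X⟧`** of `f = πX + X^q`: the unique series with
`λ ≡ X (mod deg 2)` and `λ(f(X)) = π·λ(X)`, namely Lubin–Tate's `[1]_{πX, f}` over the field `F`
(where `πX ∈ 𝔉_π` as well, its formal group being `𝔾̂_a`). Standard reference: de Shalit,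
*Iwasawa theory…*, I §1.2 (`λ = lim π⁻ⁿ [πⁿ]_f`); here it is obtained from the tree's Lubin–Tate
lemma over `F`. [cite: LubinTate1965, §1 Lemma 1] [cite: deShalit1987, Ch. I §1.2] -/
def ltLog : PowerSeries F :=
  hom (isLTRing_field F hπ) (isLTSeries_mulSeries hπ) (isLTSeries_ltPolyF (π := π)) 1

/-- `λ(0) = 0`. [folklore] -/
theorem constantCoeff_ltLog : PowerSeries.constantCoeff (ltLog hπ) = 0 := constantCoeff_hom _ _ _ _

/-- `λ ≡ X (mod deg 2)`. [folklore] -/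
theorem coeff_one_ltLog : PowerSeries.coeff 1 (ltLog hπ) = 1 := coeff_one_hom _ _ _ _

/-- **The functional equation `λ(f(X)) = π · λ(X)`.** [cite: LubinTate1965, §1 Lemma 1] -/
theorem subst_ltPolyF_ltLog :
    PowerSeries.subst (ltPolyF F π) (ltLog hπ) = PowerSeries.C ((π : 𝒪[F]) : F) * ltLog hπ := by
  rw [ltLog, ← subst_hom (isLTRing_field F hπ) (isLTSeries_mulSeries hπ) (isLTSeries_ltPolyF (π := π)) 1,
    subst_mulSeries _ _ (constantCoeff_hom' _ _ _ _)]
  rfl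

/-- **Uniqueness of the logarithm**: a series `≡ X (mod deg 2)` with `Λ(f(X)) = πΛ(X)` is `λ_f`.
[cite: LubinTate1965, §1 Lemma 1] -/
theorem eq_ltLog {Λ : PowerSeries F} (h0 : PowerSeries.constantCoeff Λ = 0) (h1 : PowerSeries.coeff 1 Λ = 1)
    (h2 : PowerSeries.subst (ltPolyF F π) Λ = PowerSeries.C ((π : 𝒪[F]) : F) * Λ) : Λ = ltLog hπ := by
  refine eq_hom (isLTRing_field F hπ) (isLTSeries_mulSeries hπ) (isLTSeries_ltPolyF (π := π)) h0 h1 ?_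
  rw [h2, subst_mulSeries _ _ (show MvPowerSeries.constantCoeff Λ = 0 from h0)]
  rfl

/-- The endomorphisms `[b]` of `πX` over `F` are the linear series `bX`. [folklore] -/
theorem hom_mulSeries (b : F) :
    hom (isLTRing_field F hπ) (isLTSeries_mulSeries hπ) (isLTSeries_mulSeries hπ) b =
      PowerSeries.C b * PowerSeries.X := by
  symm
  have h0 : PowerSeries.constantCoeff (PowerSeries.C b * PowerSeries.X : PowerSeries F) = 0 := by simp
  refine eq_hom _ _ _ h0 (by simp) ?_
  have hs' : PowerSeries.HasSubst (mulSeries F π) :=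
    PowerSeries.HasSubst.of_constantCoeff_zero' (isLTSeries_mulSeries hπ).constantCoeff_eq_zero
  rw [subst_mulSeries _ _ (show MvPowerSeries.constantCoeff (PowerSeries.C b * PowerSeries.X : PowerSeries F) = 0 from h0),
    PowerSeries.subst_mul hs', PowerSeries.subst_C, PowerSeries.subst_X hs', mulSeries_def]
  change PowerSeries.C ((π : 𝒪[F]) : F) * (PowerSeries.C b * PowerSeries.X) =
    PowerSeries.C b * (PowerSeries.C ((π : 𝒪[F]) : F) * PowerSeries.X)
  ring

/-- `[b]_f` over `F` is `[b]_f` over `𝒪_F`, mapped. [folklore] -/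
theorem hom_ltPolyF (b : 𝒪[F]) :
    hom (isLTRing_field F hπ) (isLTSeries_ltPolyF (π := π)) (isLTSeries_ltPolyF (π := π)) (b : F) =
      PowerSeries.map (algebraMap 𝒪[F] F)
        (hom (isLTRing_integer F hπ) (isLTSeries_ltPoly F) (isLTSeries_ltPoly F) b) := by
  symm
  refine eq_hom _ _ _ ?_ ?_ ?_
  · rw [← PowerSeries.coeff_zero_eq_constantCoeff_apply, PowerSeries.coeff_map,
      PowerSeries.coeff_zero_eq_constantCoeff_apply, constantCoeff_hom, map_zero]
  · rw [PowerSeries.coeff_map, coeff_one_hom]; rfl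
  · have h := congrArg (PowerSeries.map (algebraMap 𝒪[F] F))
      (subst_hom (isLTRing_integer F hπ) (isLTSeries_ltPoly F) (isLTSeries_ltPoly F) b)
    rw [map_subst₁F _ (constantCoeff_hom _ _ _ _), map_subst₁F _ (isLTSeries_ltPoly F).constantCoeff_eq_zero] at h
    exact h

/-- **`λ ∘ [b]_f = b · λ`** for `b ∈ 𝒪_F` (`[1]_{πX,f} ∘ [b]_{f,f} = [b]_{πX,f} = [b]_{πX,πX} ∘ [1]_{πX,f}`
and `[b]_{πX,πX} = bX`). [cite: LubinTate1965, §1 Thm. 1 (9)] -/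
theorem subst_hom_ltLog (b : 𝒪[F]) :
    PowerSeries.subst (PowerSeries.map (algebraMap 𝒪[F] F)
        (hom (isLTRing_integer F hπ) (isLTSeries_ltPoly F) (isLTSeries_ltPoly F) b)) (ltLog hπ) =
      PowerSeries.C (b : F) * ltLog hπ := by
  have h1 := hom_comp_hom (isLTRing_field F hπ) (isLTSeries_mulSeries hπ) (isLTSeries_ltPolyF (π := π))
    (isLTSeries_ltPolyF (π := π)) 1 (b : F)
  have h2 := hom_comp_hom (isLTRing_field F hπ) (isLTSeries_mulSeries hπ) (isLTSeries_mulSeries hπ)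
    (isLTSeries_ltPolyF (π := π)) (b : F) 1
  rw [one_mul] at h1
  rw [mul_one, hom_mulSeries hπ] at h2
  rw [← hom_ltPolyF hπ b, ltLog, h1, ← h2,
    PowerSeries.subst_mul (PowerSeries.HasSubst.of_constantCoeff_zero' (constantCoeff_hom _ _ _ _)),
    PowerSeries.subst_C, PowerSeries.subst_X (PowerSeries.HasSubst.of_constantCoeff_zero' (constantCoeff_hom _ _ _ _))]
  rfl

end Literature.NumberTheory.GaloisRepresentations

end
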